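import Summits.AtomisticToContinuum.Crystallization.Theorems.HullExactificationCascadeHcpLandscapeGapStubBoxMinimiser
import Summits.AtomisticToContinuum.Crystallization.Theorems.PalmUnimodularRigidityLayeredLawsSelectHcpUniqueMinimiser

/-!
# `HcpLandscapeGap` (stmt-AtomisticToContinuum-12087), line `registered` (birth): stub `stub_boxMinimiserRigid`
(route `HullExactificationCascade`, crux B; skeleton `Cruxes/HcpLandscapeGap/Lines/birth.lean`)

RIGIDITY OF THE BOX MINIMISER.  Write `e(a, h) := (hcpPeriodicConfiguration ha hh).energyPerParticle lennardJones`
for the Lennard-Jones energy per particle of the hcp stacking with in-layer spacing `a` and layer spacing `h`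
(`a, h ≠ 0`), and consider the OPEN box `9/10 < a < 1`, `|h − a√(2/3)| ≤ a/100`.  If `(a, h)` lies in the box
and minimises `e` over the box, then

* `|a − 0.97129| ≤ 10⁻⁴` and `|h − 0.79294| ≤ 10⁻⁴` (the certified enclosure), and
* `(a, h)` minimises `e` over the whole open quadrant `a', h' > 0`.

Proof — bookkeeping over landed facts of crux `LayeredLawsSelectHcp` (route `PalmUnimodularRigidity`), all
`[folklore]`:

* `stub_relaxedReference`: the total energy function `hcpE` has a global minimiser `(a₀, h₀)` over the open
  quadrant with `a₀ ∈ [189/200, 199/200]`, `h₀ ∈ [77/100, 163/200]`;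
* `tube_minimiserEnclosure`: every such minimiser has `|a₀ − 0.97129| ≤ 10⁻⁴`, `|h₀ − 0.79294| ≤ 10⁻⁴`;
* `tube_hcpE_unique_minimiser`: the global minimiser of `hcpE` over the quadrant is unique;
* `ExcessDecayLiouvilleCoarseGrains.hcpEnergySeries_of_eq` (third clause): `e(a, h) = hcpE a h` for
  `a, h ≠ 0`.

The enclosure puts `(a₀, h₀)` inside our box (`0.9 < 0.97119`, `0.97139 < 1`, and
`|h₀ − a₀√(2/3)| ≤ 4·10⁻⁴ ≤ a₀/100` from `0.8164 < √(2/3) < 0.8166`); box points have positive coordinates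
(`h ≥ a(√(2/3) − 1/100) > 0`); so box-minimality of `(a, h)` gives `hcpE a h ≤ hcpE a₀ h₀ ≤ hcpE a h`, whence
`hcpE a h = hcpE a₀ h₀`, `(a, h) = (a₀, h₀)` by uniqueness, and both conjuncts follow.
-/

noncomputable section

namespace Summit.AtomisticToContinuum.Crystallization.Theorems.HcpLandscapeGapBirth

open Literature.MathematicalPhysics.StatisticalMechanics
open Summit.AtomisticToContinuum.Crystallization.Theorems.PalmUnimodularRigidity.LayeredLawsSelectHcp
  (hcpE hcpQ stub_relaxedReference tube_minimiserEnclosure tube_hcpE_unique_minimiser)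
open Summit.AtomisticToContinuum.Crystallization.Theorems.ExcessDecayLiouvilleCoarseGrains
  (hcpEnergySeries_of_eq)

open BoxMinimiser in
/-- **Stub `stub_boxMinimiserRigid` of line `registered` (birth), crux `HcpLandscapeGap`
(stmt-AtomisticToContinuum-12087): RIGIDITY OF THE BOX MINIMISER.**  If `(a, h)` (with `a, h ≠ 0`) lies in the
open box `9/10 < a < 1`, `|h − a√(2/3)| ≤ a/100` and minimises the Lennard-Jones energy per particle
`e(a', h')` of `hcpPeriodicConfiguration` over that box, then `|a − 0.97129| ≤ 10⁻⁴`, `|h − 0.79294| ≤ 10⁻⁴`,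
and `(a, h)` minimises `e` over the whole open quadrant `a', h' > 0`: the landed global minimiser `(a₀, h₀)`
of `hcpE` (`stub_relaxedReference`) is enclosed (`tube_minimiserEnclosure`), hence in the box, so
`hcpE a h = hcpE a₀ h₀` (bridge `hcpEnergySeries_of_eq`) and `(a, h) = (a₀, h₀)` by
`tube_hcpE_unique_minimiser`. [folklore] -/
theorem stub_boxMinimiserRigid : ∀ a h : ℝ, ∀ ha : a ≠ 0, ∀ hh : h ≠ 0, (9 / 10 < a ∧ a < 1 ∧ |h - a * Real.sqrt (2 / 3)| ≤ a / 100) → (∀ a' h' : ℝ, ∀ ha' : a' ≠ 0, ∀ hh' : h' ≠ 0, (9 / 10 < a' ∧ a' < 1 ∧ |h' - a' * Real.sqrt (2 / 3)| ≤ a' / 100) → (Literature.MathematicalPhysics.StatisticalMechanics.hcpPeriodicConfiguration ha hh).energyPerParticle Literature.MathematicalPhysics.StatisticalMechanics.lennardJones ≤ (Literature.MathematicalPhysics.StatisticalMechanics.hcpPeriodicConfiguration ha' hh').energyPerParticle Literature.MathematicalPhysics.StatisticalMechanics.lennardJones) → (|a - 97129 / 100000| ≤ 1 / 10000 ∧ |h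 - 79294 / 100000| ≤ 1 / 10000) ∧ (∀ a' h' : ℝ, ∀ ha' : a' ≠ 0, ∀ hh' : h' ≠ 0, 0 < a' → 0 < h' → (Literature.MathematicalPhysics.StatisticalMechanics.hcpPeriodicConfiguration ha hh).energyPerParticle Literature.MathematicalPhysics.StatisticalMechanics.lennardJones ≤ (Literature.MathematicalPhysics.StatisticalMechanics.hcpPeriodicConfiguration ha' hh').energyPerParticle Literature.MathematicalPhysics.StatisticalMechanics.lennardJones) := by
  intro a h ha hh hbox hmin
  -- the landed global minimiser of `hcpE` over the open quadrant, and its enclosure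
  obtain ⟨a₀, h₀, ha₁, ha₂, hh₁, hh₂, hglob⟩ := stub_relaxedReference
  have henc : |a₀ - 97129 / 100000| ≤ 1 / 10000 ∧ |h₀ - 79294 / 100000| ≤ 1 / 10000 :=
    tube_minimiserEnclosure a₀ h₀ ha₁ ha₂ hh₁ hh₂ hglob
  have ha₀ : 0 < a₀ := by linarith
  have hh₀ : 0 < h₀ := by linarith
  -- positivity of our box point, and the global minimiser lies in our box
  obtain ⟨hapos, hhpos⟩ := box_pos hbox
  have hbox₀ : 9 / 10 < a₀ ∧ a₀ < 1 ∧ |h₀ - a₀ * Real.sqrt (2 / 3)| ≤ a₀ / 100 :=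
    enclosure_mem_box henc.1 henc.2
  -- box-minimality against `(a₀, h₀)` and global minimality of `(a₀, h₀)` give equal energies
  have hle : hcpE a h ≤ hcpE a₀ h₀ := by
    have e1 : hcpE a h = (hcpPeriodicConfiguration ha hh).energyPerParticle lennardJones :=
      ((hcpEnergySeries_of_eq a h ha hh hcpQ rfl).2.2).symm
    have e2 : hcpE a₀ h₀ = (hcpPeriodicConfiguration ha₀.ne' hh₀.ne').energyPerParticle lennardJones :=
      ((hcpEnergySeries_of_eq a₀ h₀ ha₀.ne' hh₀.ne' hcpQ rfl).2.2).symm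
    rw [e1, e2]
    exact hmin a₀ h₀ ha₀.ne' hh₀.ne' hbox₀
  have heq : hcpE a h = hcpE a₀ h₀ := le_antisymm hle (hglob a h hapos hhpos)
  -- uniqueness of the global minimiser identifies `(a, h)` with `(a₀, h₀)`
  obtain ⟨rfl, rfl⟩ : a = a₀ ∧ h = h₀ :=
    tube_hcpE_unique_minimiser a₀ h₀ a h ha₀ hh₀ hapos hhpos hglob heq
  refine ⟨henc, fun a' h' ha' hh' ha'pos hh'pos => ?_⟩
  have e1 : hcpE a h = (hcpPeriodicConfiguration ha hh).energyPerParticle lennardJones :=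
    ((hcpEnergySeries_of_eq a h ha hh hcpQ rfl).2.2).symm
  have e3 : hcpE a' h' = (hcpPeriodicConfiguration ha' hh').energyPerParticle lennardJones :=
    ((hcpEnergySeries_of_eq a' h' ha' hh' hcpQ rfl).2.2).symm
  rw [← e1, ← e3]
  exact hglob a' h' ha'pos hh'pos

end Summit.AtomisticToContinuum.Crystallization.Theorems.HcpLandscapeGapBirth

end
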